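import Summits.BirchSwinnertonDyer.BirchSwinnertonDyer.Theorems.KolyvaginRoadThreePTDescentLocalDataDual
import Literature.NumberTheory.GaloisRepresentations.ContinuousCupProductCompat
import Literature.NumberTheory.GaloisRepresentations.BrauerTower
import Literature.AnabelianGeometry.AbsoluteAnabelian.LocalResidueMapRestriction
import HarnessLib

/-!
# The (adjoint) binder of the prime-to-`p` descent, I: the left-hand side
# `Res_{w/v} a ∪_A b'` as a twisted cup product over `Γ_{K'_w}`

Route `KolyvaginRoadThree`, crux `ZhangSharpFrameAtThreeHL` (stmt-BirchSwinnertonDyer-19574), PT road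
(C) (`PT-ROAD-DESIGN-g19.md` ADDENDUM 2, brick N3).  The last open binder of the descent certificate
`middleExact_canonical_of_descentData` (p555478) for `ρ' = ρ|_{Γ_{K'}}` is
(adjoint) `⟨Res_{w/v} a, b'⟩_w = ⟨a, Cor^D_{w/v} b'⟩_v` for THE local Tate pairings.  With
`F = K_v`, `E = K'_w`, the module `M` carries over `Γ_E` the two structures `A_w` (restrict to `K'`,
then localise) and `B_w` (localise, then restrict along `K_v → K'_w`), intertwined by `ρ(τ_w)`
(`twistHom`, `KolyvaginRoadThreePTDescentLocalData`).  This file treats the LEFT-hand side: writing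
`b' = κ_w (twist^D z)` with `z ∈ H¹(E, M^D|_v|_w)` (every `b'` is of this form),

  `ι₂( Res_{w/v} a ∪_A κ_w twist^D z ) = (ι₄ ∘ ι₃)( Res_{E/F} a ∪_B z )` in `H²(Γ_E, μₚ(Ē))`

(`lhs_cup_eq`), where `ι₁ : μₚ(K̄) → μₚ(K̄')`, `ι₂ : μₚ(K̄') → μₚ(Ē)`, `ι₃ : μₚ(K̄) → μₚ(F̄)`,
`ι₄ : μₚ(F̄) → μₚ(Ē)` are the chosen embeddings on roots of unity: cup products commute with the
module maps `(ρ(τ), κ ∘ ρ^D(τ), ι₁ ∘ τ)` (the evaluation pairing being equivariant,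
`(τ f)(τ m) = τ (f m)`), and `ι₂ ∘ ι₁ ∘ τ_w = ι₄ ∘ ι₃` on `μₚ(K̄)` EXACTLY because the conjugator is
embedding-compatible (`conjugator_embedding_spec`; with any other conjugator the two sides would
differ by the cyclotomic scalar `χ(τ)`).  Also: a general "cup products commute with compatible
pairs" lemma (`cupProduct_map_of_pair`).  THEOREMS and definitions with bodies; no named fact; no
case of BSD.  The right-hand side and the binder itself are in `KolyvaginRoadThreePTDescentAdjoint`.

References: [NeukirchSchmidtWingberg2008] I §4 (1.4.2), I §5 Prop. 1.5.3; [MilneADT2006] I §0, §2;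
[SerreGaloisCohomology1997] I §2.4; [MilneFT2022] Thm 6.8.
-/

noncomputable section

universe u v

open CategoryTheory Function NumberField IsDedekindDomain
open scoped NumberField ContRepresentation Classical

set_option linter.dupNamespace false
set_option autoImplicit false

namespace Summit.BirchSwinnertonDyer.BirchSwinnertonDyer.Theorems.KolyvaginRoadThreePT

open Field
open Literature.NumberTheory.GaloisRepresentations Literature.NumberTheory.GaloisCohomology
open Literature.NumberTheory.GaloisRepresentations.DiscreteGaloisModule (mu MuCarrier TateDual tateDual
  unramifiedSubgroup tateDualPairingLocal localTatePairing localTatePairingZMod)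
open Literature.NumberTheory.GaloisRepresentations.SemiLocal (Place algebraPlace)
open _root_.TopRep _root_.ContRepresentation _root_.ContinuousCohomology

/-! ## §0 Cup products along a compatible pair -/

section CupMap


variable {R : Type u} [CommRing R] [TopologicalSpace R]
variable {G : Type v} [Group G] [TopologicalSpace G] [IsTopologicalGroup G] [LocallyCompactSpace G]
variable {H : Type v} [Group H] [TopologicalSpace H] [IsTopologicalGroup H] [LocallyCompactSpace H]

/-- **Cup products commute with compatible pairs** `(θ : H → G, α, β, γ)`: if
`γ ⟨x, y⟩₁ = ⟨α x, β y⟩₂` then `H²(θ, γ)(a ∪₁ b) = H¹(θ, α) a ∪₂ H¹(θ, β) b`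
(`cupProduct_res` along `θ` followed by `cupProduct_map` over `H`).
[cite: NeukirchSchmidtWingberg2008, I §4 (1.4.2), §5 Prop. 1.5.3] -/
theorem cupProduct_map_of_pair {X₁ Y₁ Z₁ : TopRep.{v} R G} {X₂ Y₂ Z₂ : TopRep.{v} R H}
    (P₁ : ContPairing X₁ Y₁ Z₁) (P₂ : ContPairing X₂ Y₂ Z₂) (θ : H →ₜ* G)
    (α : TopRep.res (θ : H →* G) X₁ ⟶ X₂) (β : TopRep.res (θ : H →* G) Y₁ ⟶ Y₂)
    (γ : TopRep.res (θ : H →* G) Z₁ ⟶ Z₂)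
    (hc : ∀ x y, γ.hom (P₁.toLin x y) = P₂.toLin (α.hom x) (β.hom y))
    (a : continuousCohomology 1 X₁) (b : continuousCohomology 1 Y₁) :
    ContinuousCohomology.map θ γ 2 (P₁.cupProduct a b) =
      P₂.cupProduct (ContinuousCohomology.map θ α 1 a) (ContinuousCohomology.map θ β 1 b) := by
  have hγ : ContinuousCohomology.map θ γ 2 (P₁.cupProduct a b) =
      cohomologyMap γ 2 (ContinuousCohomology.map θ (𝟙 (TopRep.res (θ : H →* G) Z₁)) 2 (P₁.cupProduct a b)) :=
    map_comp_apply_of θ (ContinuousMonoidHom.id H) θ (fun _ => rfl) (𝟙 _) (resIdHom γ) γ (fun _ => rfl) 2 _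
  have hα : ContinuousCohomology.map θ α 1 a =
      cohomologyMap α 1 (ContinuousCohomology.map θ (𝟙 (TopRep.res (θ : H →* G) X₁)) 1 a) :=
    map_comp_apply_of θ (ContinuousMonoidHom.id H) θ (fun _ => rfl) (𝟙 _) (resIdHom α) α (fun _ => rfl) 1 _
  have hβ : ContinuousCohomology.map θ β 1 b =
      cohomologyMap β 1 (ContinuousCohomology.map θ (𝟙 (TopRep.res (θ : H →* G) Y₁)) 1 b) :=
    map_comp_apply_of θ (ContinuousMonoidHom.id H) θ (fun _ => rfl) (𝟙 _) (resIdHom β) β (fun _ => rfl) 1 _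
  rw [hγ, hα, hβ, ContPairing.cupProduct_res]
  exact ContPairing.cupProduct_map (P₁.restrict θ) P₂ α β γ hc _ _

end CupMap

/-! ## §1 `galoisCohomology.map` as `cohomologyMap` -/

section MapEq


variable {L : Type u} [Field L] {N N' : Type u} [AddCommGroup N] [TopologicalSpace N] [DiscreteTopology N]
  [AddCommGroup N'] [TopologicalSpace N'] [DiscreteTopology N']

/-- The morphism of `TopRep` attached to an intertwining map of discrete Galois modules. [folklore] -/
abbrev homOf {τ : DiscreteGaloisModule L N} {τ' : DiscreteGaloisModule L N'}
    (f : τ.toContRepresentation →ⁱL τ'.toContRepresentation) : τ.toTopRep ⟶ τ'.toTopRep :=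
  TopRep.ofHom ⟨f.toContinuousLinearMap, f.isIntertwining'⟩

/-- `galoisCohomology.map f n = cohomologyMap (homOf f) n`. [folklore] -/
theorem galoisCohomology_map_eq_cohomologyMap {τ : DiscreteGaloisModule L N} {τ' : DiscreteGaloisModule L N'}
    (f : τ.toContRepresentation →ⁱL τ'.toContRepresentation) (n : ℕ) (c : galoisCohomology τ n) :
    galoisCohomology.map f n c = cohomologyMap (homOf f) n c :=
  rfl

end MapEq


/-! ## §2 The modules and pairings at `v` and at `w` -/

section Adjoint

variable {K K' : Type} [Field K] [NumberField K] [Field K'] [NumberField K'] [Algebra K K']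
variable {M : Type} [AddCommGroup M] [TopologicalSpace M] [DiscreteTopology M] [Finite M]
variable {p : ℕ} [NeZero p] (ρ : DiscreteGaloisModule K M)
variable (v : HeightOneSpectrum (𝓞 K)) (w : Place K K' v)

attribute [local instance] absoluteGaloisGroup_compactSpace

local notation "F" => HeightOneSpectrum.adicCompletion K v
local notation "E" => HeightOneSpectrum.adicCompletion K' (w : HeightOneSpectrum (𝓞 K'))

/-- The local Tate pairing data at `v` restricted to `Γ_{K'_w}` along `K_v → K'_w`
(the `B`-structures): `M|_v|_w × M^D|_v|_w → μₚ(K̄)|_v|_w`. [cite: MilneADT2006, Ch. I §0] -/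
def pairingB : ContPairing
    (DiscreteGaloisModule.toTopRep ((GaloisRep.toLocal v ρ).restrictField E))
    (DiscreteGaloisModule.toTopRep ((GaloisRep.toLocal v (ρ.tateDual p)).restrictField E))
    (DiscreteGaloisModule.toTopRep ((GaloisRep.toLocal v (mu K p)).restrictField E)) :=
  (tateDualPairingLocal ρ p (Sum.inr v)).restrict (absGaloisRestrict F E)

omit [NeZero p] in
/-- Unfolding `pairingB`: evaluation. [cite: MilneADT2006, Ch. I §0] -/
@[simp] theorem pairingB_toLin_apply (m : M) (f : TateDual K M p) :
    (pairingB (p := p) ρ v w).toLin m f = f m := rfl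

/-- The coefficient morphism `μₚ(K̄)|_v|_w → μₚ(K̄')|_w`, `ζ ↦ ι₁(τ_w • ζ)` (`ι₁ = muTransfer K K'`,
`τ_w = conjugator v w`), intertwining by `conjugator_spec` and the `Γ_{K'}`-equivariance of `ι₁`.
[cite: SerreGaloisCohomology1997, I §2.4] -/
def muTwistHom :
    DiscreteGaloisModule.toTopRep ((GaloisRep.toLocal v (mu K p)).restrictField E) ⟶
      DiscreteGaloisModule.toTopRep (GaloisRep.toLocal (w : HeightOneSpectrum (𝓞 K')) ((mu K p).restrictField K')) :=
  homOf (twistHom v w (mu K p))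

/-- The coefficient morphism `μₚ(K̄)|_{K'}|_w → μₚ(K̄')|_w`, `ζ ↦ ι₁ ζ`. [cite: SerreGaloisCohomology1997, I §2.4] -/
def muKappaHom :
    DiscreteGaloisModule.toTopRep (GaloisRep.toLocal (w : HeightOneSpectrum (𝓞 K')) ((mu K p).restrictField K')) ⟶
      DiscreteGaloisModule.toTopRep (GaloisRep.toLocal (w : HeightOneSpectrum (𝓞 K')) (mu K' p)) :=
  TopRep.ofHom ⟨⟨(muTransfer K K' p).toIntLinearMap, continuous_of_discreteTopology⟩, fun σ => by
    refine ContinuousLinearMap.ext fun ζ => ?_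
    exact muTransfer_mu K K' p _ ζ⟩

/-- The coefficient morphism `μₚ(K̄)|_v|_w → μₚ(\overline{K'_w})`, `ζ ↦ ι₄(ι₃ ζ)`
(`ι₃ = muTransfer K K_v`, `ι₄ = muRes K_v K'_w`). [cite: SerreGaloisCohomology1997, I §2.4] -/
def muEmbHom :
    DiscreteGaloisModule.toTopRep ((GaloisRep.toLocal v (mu K p)).restrictField E) ⟶
      DiscreteGaloisModule.toTopRep (mu E p) :=
  TopRep.ofHom ⟨⟨((Literature.AnabelianGeometry.AbsoluteAnabelian.Prop121vii.muRes F E p).comp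
      (muTransfer K F p)).toIntLinearMap, continuous_of_discreteTopology⟩, fun σ => by
    refine ContinuousLinearMap.ext fun ζ => ?_
    change Literature.AnabelianGeometry.AbsoluteAnabelian.Prop121vii.muRes F E p
        (muTransfer K F p (mu K p (absGaloisRestrict K F (absGaloisRestrict F E σ)) ζ)) =
      mu E p σ (Literature.AnabelianGeometry.AbsoluteAnabelian.Prop121vii.muRes F E p (muTransfer K F p ζ))
    rw [muTransfer_mu, Literature.AnabelianGeometry.AbsoluteAnabelian.Prop121vii.muRes_smul]⟩

/-- **Pointwise identity of the two coefficient routes**: `ι₂(ι₁(τ_w • ζ)) = ι₄(ι₃ ζ)` — the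
embedding property `e_v(τ_w⁻¹ • x) = e_{K'} x` of the conjugator (`conjugator_embedding_spec`).
[cite: MilneFT2022, Ch. 6 Thm 6.8 & Rmk 6.9] -/
theorem muTwistHom_muKappaHom_muLocalIso (ζ : MuCarrier K p) :
    (muLocalIso (w : HeightOneSpectrum (𝓞 K')) p).hom.hom ((muKappaHom (p := p) v w).hom
        ((muTwistHom (p := p) v w).hom ζ)) =
      (muEmbHom (p := p) v w).hom ζ := by
  apply muVal_injective E p
  refine Units.ext ?_
  change ((absClosureEmbedding K' E : AlgebraicClosure K' →* AlgebraicClosure E)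
      ((absClosureEmbedding K K' : AlgebraicClosure K →* AlgebraicClosure K')
        ((muVal K p (mu K p (conjugator v w) ζ) : (AlgebraicClosure K)ˣ) : AlgebraicClosure K))) =
    (absClosureEmbedding F E).toRingHom.toMonoidHom
      ((absClosureEmbedding K F : AlgebraicClosure K →* AlgebraicClosure F)
        ((muVal K p ζ : (AlgebraicClosure K)ˣ) : AlgebraicClosure K))
  rw [muVal_apply, Units.coe_smul]
  change absClosureEmbedding K' E (absClosureEmbedding K K' (conjugator v w • _)) =
    absClosureEmbedding F E (absClosureEmbedding K F _)
  rw [← conjugator_embedding_spec v w, inv_smul_smul]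


/-! ## §3 The left-hand side as a `B`-cup product -/

omit [Finite M] in
/-- `Res_{w/v} a = H¹(ρ(τ_w)) (Res_{K'_w/K_v} a)` as a `cohomologyMap`. [cite: SerreGaloisCohomology1997, I §2.4] -/
theorem localRes_eq_cohomologyMap (a : galoisCohomology (GaloisRep.toLocal v ρ) 1) :
    localRes v w ρ a = cohomologyMap (homOf (twistHom v w ρ)) 1
      (galoisCohomology.res (GaloisRep.toLocal v ρ) E 1 a) :=
  rfl

/-- `κ_w (twist^D z) = H¹(ρ^D(τ_w) ≫ κ_w) z` as a `cohomologyMap`. [cite: SerreGaloisCohomology1997, I §2.4] -/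
theorem dualTransferLocal_twist_eq_cohomologyMap
    (z : galoisCohomology ((GaloisRep.toLocal v (ρ.tateDual p)).restrictField E) 1) :
    dualTransferLocal (p := p) ρ v w (twist v w (ρ.tateDual p) z) =
      cohomologyMap (homOf (twistHom v w (ρ.tateDual p)) ≫
        homOf ((dualKappa (K' := K') (p := p) ρ).restrictField E)) 1 z := by
  rw [cohomologyMap_comp_apply]
  rfl

/-- **The left-hand side cup product is the twisted `B`-cup product**:
`ι₂( Res_{w/v} a ∪_A κ_w(twist^D z) ) = (ι₄ι₃)( Res a ∪_B z )` in `H²(K'_w, μₚ)` — cup products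
commute with the module maps `(ρ(τ), κ ∘ ρ^D(τ), ι₁ ∘ τ)` (`cupProduct_map`, the evaluation pairing
being equivariant: `(τ•f)(τ•m) = τ•f(m)`), and `ι₂ ∘ ι₁ ∘ τ = ι₄ ∘ ι₃` on `μₚ(K̄)`
(`muTwistHom_muKappaHom_muLocalIso`). [cite: NeukirchSchmidtWingberg2008, I §4 (1.4.2)] -/
theorem lhs_cup_eq (a : galoisCohomology (GaloisRep.toLocal v ρ) 1)
    (z : galoisCohomology ((GaloisRep.toLocal v (ρ.tateDual p)).restrictField E) 1) :
    cohomologyMap (muLocalIso (w : HeightOneSpectrum (𝓞 K')) p).hom 2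
      (localTatePairing (ρ.restrictField K') p (Sum.inr (w : HeightOneSpectrum (𝓞 K')))
        (localRes v w ρ a) (dualTransferLocal (p := p) ρ v w (twist v w (ρ.tateDual p) z))) =
    cohomologyMap (muEmbHom (p := p) v w) 2
      ((pairingB (p := p) ρ v w).cupProduct (galoisCohomology.res (GaloisRep.toLocal v ρ) E 1 a) z) := by
  rw [localRes_eq_cohomologyMap, dualTransferLocal_twist_eq_cohomologyMap]
  have hc : ∀ (m : M) (f : TateDual K M p),
      (muTwistHom (p := p) v w ≫ muKappaHom (p := p) v w).hom ((pairingB (p := p) ρ v w).toLin m f) =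
        (tateDualPairingLocal (ρ.restrictField K') p (Sum.inr (w : HeightOneSpectrum (𝓞 K')))).toLin
          ((homOf (twistHom v w ρ)).hom m)
          ((homOf (twistHom v w (ρ.tateDual p)) ≫
            homOf ((dualKappa (K' := K') (p := p) ρ).restrictField E)).hom f) := by
    intro m f
    change muTransfer K K' p (mu K p (conjugator v w) (f m)) =
      muTransfer K K' p ((ρ.tateDual p (conjugator v w) f) (ρ (conjugator v w) m))
    rw [DiscreteGaloisModule.tateDual_apply_apply_apply, ← rep_mul_apply, inv_mul_cancel, rep_one_apply]
  have hcup := ContPairing.cupProduct_map (pairingB (p := p) ρ v w)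
    (tateDualPairingLocal (ρ.restrictField K') p (Sum.inr (w : HeightOneSpectrum (𝓞 K'))))
    (homOf (twistHom v w ρ))
    (homOf (twistHom v w (ρ.tateDual p)) ≫ homOf ((dualKappa (K' := K') (p := p) ρ).restrictField E))
    (muTwistHom (p := p) v w ≫ muKappaHom (p := p) v w) hc
    (galoisCohomology.res (GaloisRep.toLocal v ρ) E 1 a) z
  have heq : (muTwistHom (p := p) v w ≫ muKappaHom (p := p) v w) ≫
      (muLocalIso (w : HeightOneSpectrum (𝓞 K')) p).hom = muEmbHom (p := p) v w :=
    TopRep.hom_ext (ContIntertwiningMap.ext (ContinuousLinearMap.ext fun ζ =>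
      muTwistHom_muKappaHom_muLocalIso (p := p) v w ζ))
  have h3 : cohomologyMap (muLocalIso (w : HeightOneSpectrum (𝓞 K')) p).hom 2
      (cohomologyMap (muTwistHom (p := p) v w ≫ muKappaHom (p := p) v w) 2
        ((pairingB (p := p) ρ v w).cupProduct (galoisCohomology.res (GaloisRep.toLocal v ρ) E 1 a) z)) =
      cohomologyMap (muEmbHom (p := p) v w) 2
        ((pairingB (p := p) ρ v w).cupProduct (galoisCohomology.res (GaloisRep.toLocal v ρ) E 1 a) z) := by
    rw [← heq]
    exact (cohomologyMap_comp_apply (muTwistHom (p := p) v w ≫ muKappaHom (p := p) v w)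
      (muLocalIso (w : HeightOneSpectrum (𝓞 K')) p).hom 2 _).symm
  exact (congrArg (cohomologyMap (muLocalIso (w : HeightOneSpectrum (𝓞 K')) p).hom 2) hcup).symm.trans h3

end Adjoint

end Summit.BirchSwinnertonDyer.BirchSwinnertonDyer.Theorems.KolyvaginRoadThreePT

end
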